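import Literature.Barriers.ValiantsHypothesis.KRST2022AsPrinted
import Literature.Computability.AlgebraicComplexity.ApproximativeRootClosure
import Literature.Computability.AlgebraicComplexity.PermanentMonotone
import HarnessLib

/-!
# CKRST 2020, arXiv v4 §5.5 — `VNP`-succinct hitting sets for circuits with LARGE DEGREE under
# APPROXIMATIVE hardness of the permanent (Def. 1.12, Lemma 5.11, Thm. 5.12, Thm. 1.13) — PROVED

P. Chatterjee, M. Kumar, C. Ramya, R. Saptharishi, A. Tengse, *On the existence of algebraically
natural proofs*, FOCS 2020; arXiv:2004.14147 **v4** (the version merging KRST 2022), §1.3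
(Def. 1.12, Thm. 1.13) and §5.5 "`VNP`-succinct hitting sets for circuits with large degree"
(Lemma 5.10 = [B18, Thm. 1.3], Lemma 5.11, Thm. 5.12). Typed literature, cell val-lit (t20, NP
corpus; last untyped section of the default source; EXTEND of `CKRST20NaturalProofsExist.lean` and
of the KRST files `AlgebraicNaturalProofsKRST{,VNP}.lean` / `KRST2022AsPrinted.lean`, whose EXACT
versions (v4 Thm. 1.10 / Thm. 5.8 = KRST Main Theorem) these statements strengthen). Bears on
route `BarrierLever`, rung V4 (item `KRSTForVP`, GAP row N4 context). HONEST FRAMING: a CONDITIONAL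
barrier theorem ("if the permanent is hard even approximately, then `VNP` has no efficiently
computable equations OF ANY DEGREE"); its hypothesis implies `VP ≠ VNP`, which is NOT proved, and
nothing here is progress on it.

## What is typed, and how (0 named facts; every statement is a definition with body or a theorem)

* Def. 1.12 (approximative circuits / complexity) = the tree's `borderComplexity`
  (`ApproximativeRootClosure.lean`; rendering note there: circuits over `F((ε)) ⊇ F(ε)`, so a
  `borderComplexity` lower bound implies the printed hypothesis' lower bound).
* `SizeDistinguishers F n a` — the equation class of Thm. 1.13 / Thm. 5.12: polynomials in the
  `N = binom(2n,n)` coefficient variables of circuit size `≤ N^a` and ARBITRARY degree ("efficiently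
  computable equations … irrespective of their degree"; "`VP_nb`" = no degree bound). The tree's
  `Distinguishers F n a` (size AND degree `≤ N^a`) is the subclass `distinguishers_subset_sizeDistinguishers`.
* `PermanentBorderExpHardWith F c m₀` — the hypothesis "`Perm_m` requires APPROXIMATIVE circuits of
  size `2^{m^ε}`" in the tree's ℕ-arithmetic (`ε = 1/c`, `2^j ≤ L̲(per_{j^c})` for `j ≥ m₀`; same
  almost-everywhere subsequence reading as the tree's `PermanentExpHardWith`, which it implies:
  `PermanentBorderExpHardWith.permanentExpHardWith`).
* Lemma 5.10 (= [B18, Thm. 1.3], "closure under taking factors", approximative): used in print only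
  for the factor `z - f(y_S)` of the hybrid polynomial; that case is PROVED in the tree
  (`borderComplexity_le_pow_of_isRoot`); the general-factor statement is cited, not vendored.
* **Lemma 5.11 ("HSG from approximative hardness") — PROVED**:
  `borderComplexity_le_of_kiGenerator_annihilated` / `kiGenerator_isHittingSetGenerator_of_borderHard`:
  for a design with pairwise intersections `≤ r` and `f` with
  `L̲(f) > (deg f + 2)³ · (s + #ι (deg f + 1)^r (2 deg f + 2) + #β + 4)`, `KI-gen(f)` hits every
  nonzero `D` with `L(D) ≤ s` — NO HYPOTHESIS ON `deg D` (print: size `≤ s^{0.1}/(N (d+1)^n)`, individual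
  degree `d`; tree constants, total degree, the explicit polynomial in place of the exponent `0.1`).
  Proof = the tree's hybrid argument `exists_root_of_kiGenerator_annihilated` (KI Lemma 30 part I,
  whose degree bound on the annihilator is simply not used) + Bürgisser's approximative root bound.
* The fixed-`n` engines `isSuccinctHittingSet_sizeDistinguishers_of_borderHard_designGenerator` and
  `isSuccinctHittingSet_sizeDistinguishers_of_permanent_borderHard` (mirror of
  `AlgebraicNaturalProofsKI.isSuccinctHittingSet_of_hard_designGenerator` /
  `…_of_permanent_hard`, with the SAME numeric threshold `(…)^7`, so the §3.5 bookkeeping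
  `kiBound_lt_two_pow` is reused verbatim), the class-generic asymptotic form
  `isSuccinctHittingSet_sizeDistinguishers_of_permanentBorderExpHard`, and:
* **Thm. 1.13 ("Conditional approximative hardness of equations for VNP": `VP_nb` has `VNP`-succinct
  hitting sets, so there are no efficiently computable equations for `VNP`) — PROVED** in the tree's
  frame: `succinctHittingSets_sizeDistinguishers_VNP_of_permanentBorderExpHard`
  (`PermanentBorderExpHardWith F c m₀ → ∃ b ∀ a ∃ n₀ ∀ n ≥ n₀,
  IsSuccinctHittingSet (degLEMonomials n) (SmallDefinable F n b) (SizeDistinguishers F n a)`) and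
  `not_exists_isNaturalProof_sizeDistinguishers_VNP_of_permanentBorderExpHard`.
* **Thm. 5.12 ("Approximative hardness of equations for VNP", the pointwise slice statement) —
  PROVED** in the quantifier shape of the tree's `KRST2022_mainThm_pointwise` / `_asPrinted` with
  the degree clause DROPPED: `CKRST2020.thm_5_12_pointwise`, `CKRST2020.thm_5_12_asPrinted`
  (for every `c` one `b`, for every level `a`, all large `n`, every `m < (n+1)^{4c}` with
  `2^{n^4} ≤ L̲(per_m)`: every nonzero `P` vanishing on the coefficient vectors of
  `SmallDefinable F n b` has `size(P) > N^a`, whatever its degree). Regime `d = n` of the printed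
  "any `d ≤ n`", as in the tree's KRST files (their TODO); print's "`size(P) ≥ N^{c·m^ε}`" is rendered,
  as there, by super-polynomiality level by level.
* **Thm. 1.13 in the printed "infinitely often" reading — PROVED** (§ IO below, twin of
  `AlgebraicNaturalProofsKRSTIO`): `PermanentBorderExpHardIO F c` ("`Perm_m` requires approximative
  size `2^{m^ε}` for infinitely many `m = j^c`") gives ONE `b` with, for every level `a`, INFINITELY
  MANY `n` at which `SmallDefinable F n b` hits `SizeDistinguishers F n a`
  (`succinctHittingSets_sizeDistinguishers_VNP_io_of_permanentBorderExpHardIO`).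
* **"`VNP` has no efficiently computable equations, of any degree" in family form** (§ Equations
  below, twin of `KRST2022AsPrinted.HasEfficientEquations` / `KRST2022_not_hasEfficientEquations_VNP`):
  `HasEfficientSizeEquations F 𝒞` (a family `P_n ≠ 0` of size `≤ N^a`, NO degree bound, eventually
  vanishing on every slice `𝒞 n b`), `HasEfficientEquations → HasEfficientSizeEquations`, and
  `CKRST2020.thm_1_13_not_hasEfficientSizeEquations_VNP{,_io}`:
  `PermanentBorderExpHard{With,IO} → ¬ HasEfficientSizeEquations F (SmallDefinable F)`.

## References

* [ChatterjeeKumarRamyaSaptharishiTengse2020] arXiv:2004.14147 v4: Def. 1.12 (TeX L346–350),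
  Thm. 1.13 (L357–362, restated L1753), Lemma 5.10 (L1726–1729), Lemma 5.11 (L1733–1740),
  Thm. 5.12 (L1745–1749), proof sketch L1731 and L1742–1743; numbering: thmtools counter shared
  with equations (thmmacros.tex), checked against §1 (Thm. 1.6 = `CKRST2020_thm_1_1`'s source).
  TeX of record: cell HOME/lit/src/2004.14147/main.tex.
* [Burgisser2004Factors] Thm. 1.3 (arXiv:1812.06828), via `ApproximativeRootClosure.lean`.
* [KumarRamyaSaptharishiTengse2022] Lemma 8, §3.4–3.5 (the exact versions, tree files
  `AlgebraicNaturalProofsKI/KRST/KRSTVNP.lean`, `KRST2022AsPrinted.lean`).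
* [KabanetsImpagliazzo2003] Lemma 30 (hybrid argument, `KabanetsImpagliazzoGenerator.lean`).
-/

noncomputable section

namespace Literature.Barriers.ValiantsHypothesis

open Literature.Computability.AlgebraicComplexity Literature.Computability.MetaComplexity
  MvPolynomial

/-! ### The equation class without degree bound, and the approximative hardness hypothesis -/

section Classes

variable (F : Type*) [Field F]

/-- **The equation class of v4 Thm. 1.13 / Thm. 5.12 — "efficiently computable equations,
irrespective of their degree"**: polynomials in the `N = binom(2n,n)` coefficient variables of
fan-in-two circuit size `≤ N^a`, with NO degree bound (`VP_nb`-type distinguishers; compare the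
tree's `Distinguishers F n a`, size AND degree `≤ N^a`).
[cite: ChatterjeeKumarRamyaSaptharishiTengse2020, Thm. 1.13 and §5.5 (arXiv v4)] -/
def SizeDistinguishers (n a : ℕ) : Set (MvPolynomial (degLEMonomials n) F) :=
  {D | complexity D ≤ (Nat.choose (2 * n) n) ^ a}

variable {F}

/-- Bounded-degree distinguishers are size-bounded distinguishers. [cite: ChatterjeeKumarRamyaSaptharishiTengse2020, §5.5 (arXiv v4)] -/
theorem distinguishers_subset_sizeDistinguishers (n a : ℕ) :
    Distinguishers F n a ⊆ SizeDistinguishers F n a := fun _ hD => hD.1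

/-- A hitting set for the size-bounded distinguishers is one for the bounded-degree ones ("`VP_nb`
has `VNP`-succinct hitting sets" implies "`VP` has"). [cite: ChatterjeeKumarRamyaSaptharishiTengse2020, Thm. 1.13 (arXiv v4)] -/
theorem IsSuccinctHittingSet.of_sizeDistinguishers {n a : ℕ} {𝒞 : Set (MvPolynomial (Fin n) F)}
    (h : IsSuccinctHittingSet (degLEMonomials n) 𝒞 (SizeDistinguishers F n a)) :
    IsSuccinctHittingSet (degLEMonomials n) 𝒞 (Distinguishers F n a) :=
  h.mono le_rfl (distinguishers_subset_sizeDistinguishers n a)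

variable (F)

/-- **Exponential APPROXIMATIVE hardness of the permanent** (hypothesis of v4 Thm. 1.13 /
Thm. 5.12: "`Perm_m` requires approximative circuits of size `2^{m^ε}`", `ε = 1/c`, in
ℕ-arithmetic and in the almost-everywhere subsequence reading of the tree's `PermanentExpHardWith`):
`2^j ≤ L̲(per_{j^c})` for all `j ≥ m₀`, `L̲ = borderComplexity`. An open hypothesis (it implies
exponential EXACT hardness, hence `VP ≠ VNP`), never asserted.
[cite: ChatterjeeKumarRamyaSaptharishiTengse2020, Thm. 1.13 (hypothesis; arXiv v4)] -/
def PermanentBorderExpHardWith (c m₀ : ℕ) : Prop :=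
  ∀ j : ℕ, m₀ ≤ j → 2 ^ j ≤ borderComplexity (perPoly (Fin (j ^ c)) F)

variable {F}

/-- Approximative hardness implies exact hardness (`L̲ ≤ L`). [cite: ChatterjeeKumarRamyaSaptharishiTengse2020, Def. 1.12 (remark following it; arXiv v4)] -/
theorem PermanentBorderExpHardWith.permanentExpHardWith {c m₀ : ℕ}
    (h : PermanentBorderExpHardWith F c m₀) : PermanentExpHardWith F c m₀ :=
  fun j hj => (h j hj).trans (borderComplexity_le_complexity _)

/-- **Monotonicity of the approximative complexity of the permanent**: `L̲(per_m) ≤ L̲(per_{m'})`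
for `m ≤ m'` (`per_m` is a projection of `per_{m'}`, `aeval_padSubst_perPoly`; projections are free
for `L̲`, `borderComplexity_aeval_le`). [cite: ChatterjeeKumarRamyaSaptharishiTengse2020, §5.5 (proof of Thm. 5.8/5.12: "if Perm_m requires size 2^{m^ε} then so does Perm_[p]"; arXiv v4)] -/
theorem borderComplexity_perPoly_mono {m m' : ℕ} (h : m ≤ m') :
    borderComplexity (perPoly (Fin m) F) ≤ borderComplexity (perPoly (Fin m') F) := by
  classical
  have hzero : ∑ ij : Fin m' × Fin m', complexity (padSubst F h ij) = 0 := by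
    refine Finset.sum_eq_zero fun ij _ => ?_
    rcases padSubst_isVarOrConst F h ij with ⟨v, hv⟩ | ⟨c, hc⟩
    · rw [hv]; exact complexity_X_holds _
    · rw [hc]; exact complexity_C_holds _
  calc borderComplexity (perPoly (Fin m) F)
      = borderComplexity (aeval (padSubst F h) (perPoly (Fin m') F)) := by
        rw [aeval_padSubst_perPoly]
    _ ≤ borderComplexity (perPoly (Fin m') F) + ∑ ij, complexity (padSubst F h ij) :=
        borderComplexity_aeval_le _ _
    _ = borderComplexity (perPoly (Fin m') F) := by rw [hzero, add_zero]

end Classes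

/-! ### Lemma 5.11: the Kabanets–Impagliazzo generator under APPROXIMATIVE hardness hits
annihilators of any degree -/

section Engine

variable {F : Type*} [Field F] [CharZero F] {ι α β : Type*}
  [Fintype ι] [DecidableEq ι] [Fintype β] [DecidableEq β] [DecidableEq α]

/-- **KI Lemma 30 in the approximative currency (the contrapositive of v4 Lemma 5.11), PROVED:**
if the blocks of `e` pairwise meet in `≤ r` points and a nonzero `D` — of ANY degree — annihilates
`KI-gen(f)`, then `L̲(f) ≤ (deg f + 2)³ · (L(D) + #ι (deg f + 1)^r (2 deg f + 2) + #β + 4)`: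
the hybrid argument (`exists_root_of_kiGenerator_annihilated`) makes `f` a root of a nonzero
`H(x, c)` with `L(H) ≤ L(D) + #ι (deg f + 1)^r (2 deg f + 2)`, and Bürgisser's theorem
(`borderComplexity_le_pow_of_isRoot`, v4 Lemma 5.10 = [B18, Thm. 1.3] for the factor `c - f(x)`)
bounds `L̲(f)` independently of `deg H`. [cite: ChatterjeeKumarRamyaSaptharishiTengse2020, Lemma 5.11 (arXiv v4 §5.5)] -/
theorem borderComplexity_le_of_kiGenerator_annihilated
    {r : ℕ} {e : ι → (β ↪ α)} (he : IsNWDesign r e) (f : MvPolynomial β F)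
    {D : MvPolynomial ι F} (hD : D ≠ 0) (hann : bind₁ (kiGenerator f e) D = 0) :
    borderComplexity f ≤ (f.totalDegree + 2) ^ 3 * (complexity D +
        Fintype.card ι * ((f.totalDegree + 1) ^ r * (2 * f.totalDegree + 2)) + Fintype.card β + 4) := by
  obtain ⟨H, hH, hroot, hc, -⟩ := exists_root_of_kiGenerator_annihilated he f hD hann
  refine (borderComplexity_le_pow_of_isRoot f hH hroot).trans ?_
  gcongr

/-- **CKRST v4 Lemma 5.11 ("HSG from approximative hardness"), PROVED with tree constants:** over a
field of characteristic zero, for a design with pairwise intersections `≤ r` and `f` with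
`L̲(f) > (deg f + 2)³ · (s + #ι (deg f + 1)^r (2 deg f + 2) + #β + 4)`, the map `KI-gen(f)` is a
hitting set generator for ALL nonzero `D` with `L(D) ≤ s` — no degree hypothesis (print: "for all
`N`-variate polynomials with circuit-size at most `s^{0.1}/(N (d+1)^n)`", `s > deg f`).
[cite: ChatterjeeKumarRamyaSaptharishiTengse2020, Lemma 5.11 (arXiv v4 §5.5)] -/
theorem kiGenerator_isHittingSetGenerator_of_borderHard
    {r : ℕ} {e : ι → (β ↪ α)} (he : IsNWDesign r e) (f : MvPolynomial β F) {s : ℕ}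
    (hhard : (f.totalDegree + 2) ^ 3 * (s +
        Fintype.card ι * ((f.totalDegree + 1) ^ r * (2 * f.totalDegree + 2)) + Fintype.card β + 4) <
        borderComplexity f)
    {D : MvPolynomial ι F} (hs : complexity D ≤ s) (hD : D ≠ 0) :
    bind₁ (kiGenerator f e) D ≠ 0 := by
  intro hann
  have h := borderComplexity_le_of_kiGenerator_annihilated he f hD hann
  have hmono : (f.totalDegree + 2) ^ 3 * (complexity D +
        Fintype.card ι * ((f.totalDegree + 1) ^ r * (2 * f.totalDegree + 2)) + Fintype.card β + 4) ≤
      (f.totalDegree + 2) ^ 3 * (s +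
        Fintype.card ι * ((f.totalDegree + 1) ^ r * (2 * f.totalDegree + 2)) + Fintype.card β + 4) := by
    gcongr
  omega

end Engine

/-! ### The fixed-`n` engines against `SizeDistinguishers` -/

section FixedN

variable {F : Type*} [Field F] [CharZero F] {α β : Type*} [Fintype β] [DecidableEq β]
  [DecidableEq α]

/-- Arithmetic: the cubic approximative threshold is below the tree's seventh-power KI threshold
(so the §3.5 bookkeeping of `AlgebraicNaturalProofsKRST` applies unchanged).
[cite: ChatterjeeKumarRamyaSaptharishiTengse2020, §5.5 (proof of Thm. 5.12, "exactly as that of Thm. 5.8"; arXiv v4)] -/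
theorem cubic_threshold_le_pow_seven (A T m q M : ℕ) (hm : m ≤ M) :
    (m + 2) ^ 3 * (A + T + q + 4) ≤ (A + T + A * max 1 M + M + q + 4) ^ 7 := by
  set X := A + T + A * max 1 M + M + q + 4 with hX
  have h1 : m + 2 ≤ X := by omega
  have h2 : A + T + q + 4 ≤ X := by omega
  have hX1 : 1 ≤ X := by omega
  calc (m + 2) ^ 3 * (A + T + q + 4) ≤ X ^ 3 * X := Nat.mul_le_mul (Nat.pow_le_pow_left h1 3) h2
    _ = X ^ 4 := by ring
    _ ≤ X ^ 7 := Nat.pow_le_pow_right hX1 (by norm_num)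

/-- **The approximative hardness door at a fixed `n`, any simple class `𝒞`** (v4 Lemma 5.11 fed
into the FSV/KRST door `isSuccinctHittingSet_of_designGenerator`): a design
`e : degLEMonomials n → (β ↪ α)` with pairwise intersections `≤ r`, an `f` whose APPROXIMATIVE
complexity exceeds the tree's KI threshold
`(N^a + N_n (deg f + 1)^r (2 deg f + 2) + N^a · max 1 (deg f) + deg f + #β + 4)^7`, and
`𝒞`-succinctness of `KI-gen(f)` give: `𝒞` hits every nonzero `D` with `L(D) ≤ N^a` — of any degree.
[cite: ChatterjeeKumarRamyaSaptharishiTengse2020, Lemma 5.11 and §5.5 (arXiv v4)] -/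
theorem isSuccinctHittingSet_sizeDistinguishers_of_borderHard_designGenerator
    {n a r : ℕ} {𝒞 : Set (MvPolynomial (Fin n) F)} {e : degLEMonomials n → (β ↪ α)}
    (he : IsNWDesign r e) (f : MvPolynomial β F)
    (hhard : ((Nat.choose (2 * n) n) ^ a +
        Fintype.card (degLEMonomials n) * ((f.totalDegree + 1) ^ r * (2 * f.totalDegree + 2)) +
        (Nat.choose (2 * n) n) ^ a * max 1 f.totalDegree + f.totalDegree + Fintype.card β + 4) ^ 7 <
        borderComplexity f)
    (hsucc : ∀ y : α → F, ∃ g ∈ 𝒞,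
      ∀ m : degLEMonomials n, coeff (m : Fin n →₀ ℕ) g = eval (y ∘ e m) f) :
    IsSuccinctHittingSet (degLEMonomials n) 𝒞 (SizeDistinguishers F n a) := by
  classical
  refine isSuccinctHittingSet_of_designGenerator (f := f) (S := fun m => ⇑(e m)) ?_ hsucc
  intro D hD hD0
  rw [← kiGenerator_eq_designGenerator]
  refine kiGenerator_isHittingSetGenerator_of_borderHard he f (lt_of_le_of_lt ?_ hhard) hD hD0
  exact cubic_threshold_le_pow_seven _ _ _ _ _ le_rfl

/-- **The approximative hardness door at a fixed `n` with KRST's data** (`f = Perm_[p]` on the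
Reed–Solomon design `krstDesign p n`): if
`L̲(per_m) > (N^a + N_n (m+1)^n (2m+2) + N^a · max 1 m + m + p + 4)^7` and the generator is
`𝒞`-succinct, then `𝒞` hits every nonzero size-`≤ N^a` distinguisher of any degree (approximative
twin of `isSuccinctHittingSet_of_permanent_hard`; `L̲(Perm_[p]) = L̲(per_m)` up to the free
injective renaming, `borderComplexity_le_borderComplexity_rename`).
[cite: ChatterjeeKumarRamyaSaptharishiTengse2020, §5.5 (proof of Thm. 5.12; arXiv v4)] -/
theorem isSuccinctHittingSet_sizeDistinguishers_of_permanent_borderHard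
    {n a m p : ℕ} [Fact p.Prime] {𝒞 : Set (MvPolynomial (Fin n) F)} (hnp : n < p)
    (hmp : m * m ≤ p)
    (hhard : ((Nat.choose (2 * n) n) ^ a +
        Fintype.card (degLEMonomials n) * ((m + 1) ^ n * (2 * m + 2)) +
        (Nat.choose (2 * n) n) ^ a * max 1 m + m + p + 4) ^ 7 <
        borderComplexity (perPoly (Fin m) F))
    (hsucc : ∀ y : ZMod p × ZMod p → F, ∃ g ∈ 𝒞,
      ∀ μ : degLEMonomials n, coeff (μ : Fin n →₀ ℕ) g =
        eval (y ∘ krstDesign p n μ) (perPad F hmp)) :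
    IsSuccinctHittingSet (degLEMonomials n) 𝒞 (SizeDistinguishers F n a) := by
  have hpad : borderComplexity (perPoly (Fin m) F) ≤ borderComplexity (perPad F hmp) :=
    borderComplexity_le_borderComplexity_rename (permPad hmp).injective _
  refine isSuccinctHittingSet_sizeDistinguishers_of_borderHard_designGenerator
    (isNWDesign_krstDesign p n hnp) (perPad F hmp) (lt_of_le_of_lt ?_ (hhard.trans_le hpad)) hsucc
  have hd := totalDegree_perPad_le (F := F) hmp
  rw [Fintype.card_fin]
  gcongr

end FixedN

/-! ### Asymptotics: Thm. 1.13 and Thm. 5.12 -/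

section Asymptotic

variable {F : Type*} [Field F] [CharZero F]

omit [CharZero F] in
/-- **Approximative hardness beats the KI bound**: under `PermanentBorderExpHardWith F c m₀`,
eventually in `n`, `kiBound a c n < L̲(per_{n^{3c}})` (hardness at `j = n³`; `kiBound_lt_two_pow`).
[cite: ChatterjeeKumarRamyaSaptharishiTengse2020, §5.5 (proof of Thm. 5.12; arXiv v4)] -/
theorem kiBound_lt_borderComplexity_perPoly {c m₀ : ℕ} (hper : PermanentBorderExpHardWith F c m₀)
    (a : ℕ) :
    ∃ n₀ : ℕ, ∀ n : ℕ, n₀ ≤ n →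
      kiBound a c n < borderComplexity (perPoly (Fin (krstBlock c n)) F) := by
  obtain ⟨n₁, hn₁⟩ := kiBound_lt_two_pow a c
  refine ⟨max n₁ (max m₀ 1), fun n hn => ?_⟩
  have hn₁' : n₁ ≤ n := (le_max_left _ _).trans hn
  have hm₀n : m₀ ≤ n := (le_max_left _ _).trans ((le_max_right _ _).trans hn)
  have h1 : 1 ≤ n := (le_max_right _ _).trans ((le_max_right _ _).trans hn)
  have hn3 : n ≤ n ^ 3 := by
    calc n = n * 1 * 1 := by ring
      _ ≤ n * n * n := by gcongr
      _ = n ^ 3 := by ring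
  have h := hper (n ^ 3) (hm₀n.trans hn3)
  rw [← pow_mul] at h
  exact (hn₁ n hn₁').trans_le h

/-- **The class-generic asymptotic form** (approximative twin of
`isSuccinctHittingSet_of_permanentExpHard`): for ANY classes `𝒞 n`, approximative exponential
hardness of the permanent and eventual `𝒞`-succinctness of KRST's generator give, for every level
`a`, eventually `IsSuccinctHittingSet (degLEMonomials n) (𝒞 n) (SizeDistinguishers F n a)`.
[cite: ChatterjeeKumarRamyaSaptharishiTengse2020, Thm. 5.12 / Thm. 1.13 (arXiv v4 §5.5)] -/
theorem isSuccinctHittingSet_sizeDistinguishers_of_permanentBorderExpHard {c m₀ : ℕ}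
    {𝒞 : ∀ n, Set (MvPolynomial (Fin n) F)}
    (hper : PermanentBorderExpHardWith F c m₀)
    (hsucc : ∃ n₀ : ℕ, ∀ n : ℕ, n₀ ≤ n → KRSTSuccinctIn F 𝒞 c n) (a : ℕ) :
    ∃ n₀ : ℕ, ∀ n : ℕ, n₀ ≤ n →
      IsSuccinctHittingSet (degLEMonomials n) (𝒞 n) (SizeDistinguishers F n a) := by
  obtain ⟨n₁, hn₁⟩ := kiBound_lt_borderComplexity_perPoly hper a
  obtain ⟨n₂, hn₂⟩ := hsucc
  refine ⟨max n₁ n₂, fun n hn => ?_⟩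
  exact isSuccinctHittingSet_sizeDistinguishers_of_permanent_borderHard (lt_krstPrime c n)
    (krstBlock_sq_le_krstPrime c n) (hn₁ n ((le_max_left _ _).trans hn))
    (hn₂ n ((le_max_right _ _).trans hn))

/-- **CKRST v4 Thm. 1.13 ("Conditional approximative hardness of equations for VNP": "Suppose
that the permanent family `Perm_m` requires approximative circuits of size `2^{m^ε}`. Then
`VP_nb` has `VNP`-succinct hitting sets, and so there are no efficiently computable equations for
`VNP`") — PROVED in the tree's frame.** Under `PermanentBorderExpHardWith F c m₀` there is ONE
`VNP`-size exponent `b` such that for every level `a`, eventually in `n`, the coefficient vectors of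
`SmallDefinable F n b` ("`VNP(n, d = n)`") hit every nonzero polynomial of circuit size `≤ N^a` in
the `N = binom(2n,n)` coefficient variables — WHATEVER ITS DEGREE. Ingredients: Lemma 5.11
(`kiGenerator_isHittingSetGenerator_of_borderHard`), KRST's Reed–Solomon designs and §3.5
bookkeeping (tree), KRST §3.4 `VNP`-succinctness PROVED in the tree (`krstSuccinctIn_smallDefinable`).
VARIANT NOTE as for the exact theorem (`succinctHittingSetsFromVNP_of_permanentExpHard`): this is
the almost-everywhere-from-almost-everywhere form obtained by the printed METHOD; print's i.o./i.o.
reading follows along the hard subsequence in the same way.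
[cite: ChatterjeeKumarRamyaSaptharishiTengse2020, Thm. 1.13 (arXiv v4; = restated Thm. after Thm. 5.12)] -/
theorem succinctHittingSets_sizeDistinguishers_VNP_of_permanentBorderExpHard {c m₀ : ℕ}
    (hper : PermanentBorderExpHardWith F c m₀) :
    ∃ b : ℕ, ∀ a : ℕ, ∃ n₀ : ℕ, ∀ n : ℕ, n₀ ≤ n →
      IsSuccinctHittingSet (degLEMonomials n) (SmallDefinable F n b) (SizeDistinguishers F n a) := by
  obtain ⟨b, n₀, hb⟩ := krstSuccinctIn_smallDefinable (F := F) c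
  exact ⟨b, fun a => isSuccinctHittingSet_sizeDistinguishers_of_permanentBorderExpHard hper ⟨n₀, hb⟩ a⟩

/-- Hence, under approximative exponential hardness of the permanent, **no efficiently computable
equation for `VNP` of any degree**: for every level `a`, eventually no nonzero `D` with
`L(D) ≤ N^a` vanishes on the coefficient vectors of `SmallDefinable F n b` (FSV Thm. 4).
[cite: ChatterjeeKumarRamyaSaptharishiTengse2020, Thm. 1.13 (arXiv v4)] -/
theorem not_exists_isNaturalProof_sizeDistinguishers_VNP_of_permanentBorderExpHard {c m₀ : ℕ}
    (hper : PermanentBorderExpHardWith F c m₀) :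
    ∃ b : ℕ, ∀ a : ℕ, ∃ n₀ : ℕ, ∀ n : ℕ, n₀ ≤ n →
      ¬ ∃ D, IsNaturalProof (degLEMonomials n) (SmallDefinable F n b) (SizeDistinguishers F n a) D := by
  obtain ⟨b, hb⟩ := succinctHittingSets_sizeDistinguishers_VNP_of_permanentBorderExpHard hper
  refine ⟨b, fun a => ?_⟩
  obtain ⟨n₀, hn₀⟩ := hb a
  refine ⟨n₀, fun n hn => ?_⟩
  rw [exists_isNaturalProof_iff, not_not]
  exact hn₀ n hn

/-- The approximative hypothesis also gives the EXACT theorem's conclusion (bounded-degree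
distinguishers), by monotonicity — consistency check with `succinctHittingSetsFromVNP_of_permanentExpHard`.
[cite: ChatterjeeKumarRamyaSaptharishiTengse2020, Thm. 1.13 and Thm. 1.10 (arXiv v4)] -/
theorem succinctHittingSetsFromVNP_of_permanentBorderExpHard {c m₀ : ℕ}
    (hper : PermanentBorderExpHardWith F c m₀) :
    ∃ b : ℕ, ∀ a : ℕ, ∃ n₀ : ℕ, ∀ n : ℕ, n₀ ≤ n →
      IsSuccinctHittingSet (degLEMonomials n) (SmallDefinable F n b) (Distinguishers F n a) :=
  succinctHittingSetsFromVNP_of_permanentExpHard hper.permanentExpHardWith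

namespace CKRST2020

/-- Arithmetic for the block size (as in `KRST2022AsPrinted`): `(n+1)^{4c} ≤ n^{9c}` for `n ≥ 2`.
[cite: ChatterjeeKumarRamyaSaptharishiTengse2020, §5.5 (proof of Thm. 5.12; arXiv v4)] -/
private theorem succ_pow_four_mul_le' (c n : ℕ) (hn : 2 ≤ n) :
    (n + 1) ^ (4 * c) ≤ krstBlock (3 * c) n := by
  have h4 : (n + 1) ^ 4 ≤ n ^ 9 := by
    have h1 : n + 1 ≤ 2 * n := by omega
    have h2 : (n + 1) ^ 4 ≤ (2 * n) ^ 4 := Nat.pow_le_pow_left h1 4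
    have h3 : (16 : ℕ) ≤ n ^ 5 := le_trans (by norm_num) (Nat.pow_le_pow_left hn 5)
    calc (n + 1) ^ 4 ≤ (2 * n) ^ 4 := h2
      _ = 16 * n ^ 4 := by ring
      _ ≤ n ^ 5 * n ^ 4 := Nat.mul_le_mul_right _ h3
      _ = n ^ 9 := by rw [← pow_add]
  unfold krstBlock
  calc (n + 1) ^ (4 * c) = ((n + 1) ^ 4) ^ c := by rw [pow_mul]
    _ ≤ (n ^ 9) ^ c := Nat.pow_le_pow_left h4 c
    _ = n ^ (3 * (3 * c)) := by rw [← pow_mul]; ring_nf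

/-- **CKRST v4 Thm. 5.12 ("Approximative hardness of equations for VNP"), POINTWISE form, PROVED**
(the approximative twin of the tree's `KRST2022_mainThm_pointwise`): for every `c` (`ε = 1/c`)
there is ONE `VNP`-size exponent `b` such that for every level `a`, all large `n` and every
`m < (n+1)^{4c}` (print: `n = m^{ε/4}`): IF `2^{n^4} ≤ L̲(per_m)` (implied by "`Perm_m` requires
approximative circuits of size `2^{m^ε}`") THEN the coefficient vectors of `SmallDefinable F n b`
("`VNP_d(n)`", regime `d = n` of the printed "any `d ≤ n`") hit every nonzero distinguisher of SIZE
`≤ N^a`, `N = binom(2n,n)`, of arbitrary degree. Proof: the engine at block exponent `3c` (`per_m`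
is a projection of `per_{n^{9c}}`, `borderComplexity_perPoly_mono`), `kiBound_lt_two_pow`, and the
proved `VNP`-succinctness. [cite: ChatterjeeKumarRamyaSaptharishiTengse2020, Thm. 5.12 (arXiv v4 §5.5)] -/
theorem thm_5_12_pointwise (c : ℕ) :
    ∃ b : ℕ, ∀ a : ℕ, ∃ n₀ : ℕ, ∀ n : ℕ, n₀ ≤ n → ∀ m : ℕ, m < (n + 1) ^ (4 * c) →
      2 ^ (n ^ 4) ≤ borderComplexity (perPoly (Fin m) F) →
        IsSuccinctHittingSet (degLEMonomials n) (SmallDefinable F n b) (SizeDistinguishers F n a) := by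
  obtain ⟨b, n₂, hsucc⟩ := krstSuccinctIn_smallDefinable (F := F) (3 * c)
  refine ⟨b, fun a => ?_⟩
  obtain ⟨n₁, hn₁⟩ := kiBound_lt_two_pow a (3 * c)
  refine ⟨max (max n₁ n₂) 2, fun n hn m hm hhard => ?_⟩
  have hn1 : n₁ ≤ n := ((le_max_left _ _).trans (le_max_left _ _)).trans hn
  have hn2 : n₂ ≤ n := ((le_max_right _ _).trans (le_max_left _ _)).trans hn
  have h2n : 2 ≤ n := (le_max_right _ _).trans hn
  -- the hard permanent is a projection of the engine's block permanent
  have hm' : m ≤ krstBlock (3 * c) n := (le_of_lt hm).trans (succ_pow_four_mul_le' c n h2n)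
  have hblock : 2 ^ (n ^ 4) ≤ borderComplexity (perPoly (Fin (krstBlock (3 * c) n)) F) :=
    hhard.trans (borderComplexity_perPoly_mono hm')
  -- the KI bound at level `a` is below `2^{n^3} ≤ 2^{n^4}`
  have h34 : 2 ^ (n ^ 3) ≤ 2 ^ (n ^ 4) :=
    Nat.pow_le_pow_right (by norm_num) (Nat.pow_le_pow_right (by omega) (by norm_num))
  have hki : kiBound a (3 * c) n < borderComplexity (perPoly (Fin (krstBlock (3 * c) n)) F) :=
    lt_of_lt_of_le (hn₁ n hn1) (h34.trans hblock)
  exact isSuccinctHittingSet_sizeDistinguishers_of_permanent_borderHard (lt_krstPrime (3 * c) n)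
    (krstBlock_sq_le_krstPrime (3 * c) n) hki (hsucc n hn2)

/-- **CKRST v4 Thm. 5.12 in its printed quantifier shape, PROVED** (approximative twin of
`KRST2022_mainThm_asPrinted`): "Suppose, for an `m` large enough, `Perm_m` requires APPROXIMATIVE
circuits of size `2^{m^ε}`. Then … for `n = m^{ε/4}` … every nonzero polynomial `P(x_1, …, x_N)` that
is an equation for `VNP_d(n)` has super-polynomial size" — here: for every `c` one `b`, for every
`a`, all large `n`, every `m < (n+1)^{4c}` with `2^{n^4} ≤ L̲(per_m)`, every nonzero `P` in the
`N = binom(2n,n)` coefficient variables vanishing on the coefficient vectors of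
`SmallDefinable F n b` has `size(P) > N^a` — with NO hypothesis on `deg P` (the difference with
Thm. 5.8 / KRST's Main Theorem). Regime `d = n`; print's "`size(P) ≥ N^{c·m^ε}`" rendered level by
level as in the tree's KRST files. [cite: ChatterjeeKumarRamyaSaptharishiTengse2020, Thm. 5.12 (arXiv v4 §5.5, TeX L1745–1749)] -/
theorem thm_5_12_asPrinted (c : ℕ) :
    ∃ b : ℕ, ∀ a : ℕ, ∃ n₀ : ℕ, ∀ n : ℕ, n₀ ≤ n → ∀ m : ℕ, m < (n + 1) ^ (4 * c) →
      2 ^ (n ^ 4) ≤ borderComplexity (perPoly (Fin m) F) →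
        ∀ P : MvPolynomial (degLEMonomials n) F, P ≠ 0 →
          (∀ f ∈ SmallDefinable F n b, eval (coeffVector (degLEMonomials n) f) P = 0) →
            (Nat.choose (2 * n) n) ^ a < complexity P := by
  obtain ⟨b, hb⟩ := thm_5_12_pointwise (F := F) c
  refine ⟨b, fun a => ?_⟩
  obtain ⟨n₀, hn₀⟩ := hb a
  refine ⟨n₀, fun n hn m hm hhard P hP hvan => ?_⟩
  by_contra hsize
  have hmem : P ∈ SizeDistinguishers F n a := not_lt.1 hsize
  obtain ⟨f, hf, hne⟩ := hn₀ n hn m hm hhard P hmem hP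
  exact hne (hvan f hf)

/-- **CKRST v4 Thm. 1.13, almost-everywhere packaging of Thm. 5.12** (approximative twin of the
tree's passage from `KRST2022_mainThm_pointwise` to `succinctHittingSetsFromVNP_of_permanentExpHard`):
`PermanentBorderExpHardWith F c m₀` gives the pointwise hypothesis at `j = n^4`, `m = n^{4c}` for
`c ≥ 1`; recorded as the implication between the two typed forms.
[cite: ChatterjeeKumarRamyaSaptharishiTengse2020, Thm. 1.13 (arXiv v4, proof after Thm. 5.12: "immediate, using the proof of Thm. 1.10")] -/
theorem thm_1_13_of_thm_5_12 {c m₀ : ℕ} (hc : 1 ≤ c) (hper : PermanentBorderExpHardWith F c m₀) :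
    ∃ b : ℕ, ∀ a : ℕ, ∃ n₀ : ℕ, ∀ n : ℕ, n₀ ≤ n →
      IsSuccinctHittingSet (degLEMonomials n) (SmallDefinable F n b) (SizeDistinguishers F n a) := by
  obtain ⟨b, hb⟩ := thm_5_12_pointwise (F := F) c
  refine ⟨b, fun a => ?_⟩
  obtain ⟨n₀, hn₀⟩ := hb a
  refine ⟨max n₀ (max m₀ 1), fun n hn => ?_⟩
  have hn₀' : n₀ ≤ n := (le_max_left _ _).trans hn
  have hm₀ : m₀ ≤ n := (le_max_left _ _).trans ((le_max_right _ _).trans hn)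
  have h1 : 1 ≤ n := (le_max_right _ _).trans ((le_max_right _ _).trans hn)
  -- hardness at `j = n^4`: `2^{n^4} ≤ L̲(per_{(n^4)^c})`, and `(n^4)^c = n^{4c} < (n+1)^{4c}`
  have hj : m₀ ≤ n ^ 4 := hm₀.trans (by
    calc n = n ^ 1 := (pow_one n).symm
      _ ≤ n ^ 4 := Nat.pow_le_pow_right h1 (by norm_num))
  have hhard := hper (n ^ 4) hj
  rw [← pow_mul] at hhard
  have hlt : n ^ (4 * c) < (n + 1) ^ (4 * c) :=
    Nat.pow_lt_pow_left (Nat.lt_succ_self n) (by omega)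
  exact hn₀ n hn₀' (n ^ (4 * c)) hlt hhard

end CKRST2020

end Asymptotic

/-! ### IO: Thm. 1.13 in the printed "infinitely often from infinitely often" reading -/

section IO

variable {F : Type*} [Field F]

variable (F) in
/-- **Exponential APPROXIMATIVE hardness of the permanent, infinitely often** (the literal
hypothesis of v4 Thm. 1.13 read as in print's proof of Thm. 1.10: "`Perm_m` is `2^{m^ε}`-hard for
infinitely many `m`", `ε = 1/c`, approximative size): for every `m₀` some `j ≥ m₀` has
`2^j ≤ L̲(per_{j^c})`. Twin of the tree's `PermanentExpHardIO`.
[cite: ChatterjeeKumarRamyaSaptharishiTengse2020, Thm. 1.13 (hypothesis; arXiv v4, proof after Thm. 5.12 / proof of Thm. 1.10 L1702–1711)] -/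
def PermanentBorderExpHardIO (c : ℕ) : Prop :=
  ∀ m₀ : ℕ, ∃ j : ℕ, m₀ ≤ j ∧ 2 ^ j ≤ borderComplexity (perPoly (Fin (j ^ c)) F)

/-- The almost-everywhere hypothesis implies the infinitely-often one.
[cite: ChatterjeeKumarRamyaSaptharishiTengse2020, §5.5 (arXiv v4)] -/
theorem PermanentBorderExpHardWith.io {c m₀ : ℕ} (h : PermanentBorderExpHardWith F c m₀) :
    PermanentBorderExpHardIO F c :=
  fun m => ⟨max m m₀, le_max_left _ _, h _ (le_max_right _ _)⟩

/-- Infinitely-often approximative hardness implies infinitely-often exact hardness (`L̲ ≤ L`).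
[cite: ChatterjeeKumarRamyaSaptharishiTengse2020, Def. 1.12 (remark following it; arXiv v4)] -/
theorem PermanentBorderExpHardIO.permanentExpHardIO {c : ℕ} (h : PermanentBorderExpHardIO F c) :
    PermanentExpHardIO F c := fun m₀ => by
  obtain ⟨j, hj, h2⟩ := h m₀
  exact ⟨j, hj, h2.trans (borderComplexity_le_complexity _)⟩

/-- **From a hard index to a good size `n`** (approximative twin of
`exists_kiBound_lt_of_hard_index`): if `2^j ≤ L̲(per_{j^c})` with `j ≥ N³`,
`N ≥ 14(2a+6c+6)+8`, then at `n = ⌈j^{1/3}⌉ ≥ N` one has `kiBound a c n < L̲(per_{n^{3c}})`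
(`borderComplexity_perPoly_mono` for the hardness side, `kiBound_le_two_pow` and `(n-1)³ < j` for
the other). [cite: ChatterjeeKumarRamyaSaptharishiTengse2020, §5.5 (proof of Thm. 5.12 / Thm. 1.13; arXiv v4)] -/
theorem exists_kiBound_lt_borderComplexity_of_hard_index (a c N : ℕ)
    (hN : 14 * (2 * a + 6 * c + 6) + 8 ≤ N) {j : ℕ} (hjN : N ^ 3 ≤ j)
    (hj : 2 ^ j ≤ borderComplexity (perPoly (Fin (j ^ c)) F)) :
    ∃ n : ℕ, N ≤ n ∧ kiBound a c n < borderComplexity (perPoly (Fin (krstBlock c n)) F) := by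
  classical
  have hex : ∃ n : ℕ, j ≤ n ^ 3 := ⟨j, Nat.le_self_pow (by norm_num) j⟩
  set n := Nat.find hex with hn
  have hjn : j ≤ n ^ 3 := Nat.find_spec hex
  have hNn : N ≤ n := by
    by_contra hlt
    push Not at hlt
    have : n ^ 3 < N ^ 3 := Nat.pow_lt_pow_left hlt (by norm_num)
    omega
  have hn1 : 1 ≤ n := le_trans (by omega) hNn
  -- minimality: `(n-1)³ < j`
  obtain ⟨k, hk⟩ : ∃ k, n = k + 1 := ⟨n - 1, by omega⟩
  have hkj : k ^ 3 < j := by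
    have := Nat.find_min hex (show k < Nat.find hex by omega)
    omega
  refine ⟨n, hNn, ?_⟩
  -- hardness side
  have hM : j ^ c ≤ krstBlock c n := by
    unfold krstBlock; rw [pow_mul]; exact Nat.pow_le_pow_left hjn c
  have hhard : 2 ^ j ≤ borderComplexity (perPoly (Fin (krstBlock c n)) F) :=
    hj.trans (borderComplexity_perPoly_mono hM)
  -- KI side
  refine lt_of_lt_of_le ?_ hhard
  refine lt_of_le_of_lt (kiBound_le_two_pow a c n) (Nat.pow_lt_pow_right (by norm_num) ?_)
  have hexp := kiBound_exponent_le_pred_cube a c k (by omega)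
  rw [hk]
  omega

variable [CharZero F]

/-- **CKRST v4 Thm. 1.13, printed ("infinitely often") form — PROVED:** over a field of
characteristic zero, if the permanent requires APPROXIMATIVE circuits of size `2^{m^{1/c}}` for
infinitely many `m` of the form `j^c` (`PermanentBorderExpHardIO F c`), then there is ONE exponent
`b` such that for every level `a` and INFINITELY MANY `n`, the coefficient vectors of
`SmallDefinable F n b` hit every nonzero polynomial of circuit size `≤ N^a` in the
`N = binom(2n,n)` coefficient variables, of arbitrary degree ("for any family `{P_N} ∈ VP_nb`, for
infinitely many `n`, `P_N(f_n) ≠ 0` for some `f_n ∈ VNP_d(n)`").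
[cite: ChatterjeeKumarRamyaSaptharishiTengse2020, Thm. 1.13 (arXiv v4; proof "immediate, using the proof of Thm. 1.10", L1751–1753)] -/
theorem succinctHittingSets_sizeDistinguishers_VNP_io_of_permanentBorderExpHardIO {c : ℕ}
    (hper : PermanentBorderExpHardIO F c) :
    ∃ b : ℕ, ∀ a n₀ : ℕ, ∃ n : ℕ, n₀ ≤ n ∧
      IsSuccinctHittingSet (degLEMonomials n) (SmallDefinable F n b) (SizeDistinguishers F n a) := by
  obtain ⟨b, N₁, hsucc⟩ := krstSuccinctIn_smallDefinable (F := F) c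
  refine ⟨b, fun a n₀ => ?_⟩
  set N := max (max n₀ N₁) (14 * (2 * a + 6 * c + 6) + 8) with hNdef
  obtain ⟨j, hjN, hj⟩ := hper (N ^ 3)
  obtain ⟨n, hNn, hki⟩ :=
    exists_kiBound_lt_borderComplexity_of_hard_index (F := F) a c N (le_max_right _ _) hjN hj
  have hn₀ : n₀ ≤ n := le_trans ((le_max_left _ _).trans (le_max_left _ _)) hNn
  have hN₁ : N₁ ≤ n := le_trans ((le_max_right _ _).trans (le_max_left _ _)) hNn
  exact ⟨n, hn₀, isSuccinctHittingSet_sizeDistinguishers_of_permanent_borderHard (lt_krstPrime c n)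
    (krstBlock_sq_le_krstPrime c n) hki (hsucc n hN₁)⟩

/-- Hence (FSV Thm. 4): under infinitely-often approximative hardness, for every level `a` there
are infinitely many `n` at which NO nonzero size-`≤ N^a` polynomial of any degree vanishes on the
coefficient vectors of the `VNP`-succinct class — "there are no efficiently computable equations
for `VNP`". [cite: ChatterjeeKumarRamyaSaptharishiTengse2020, Thm. 1.13 (arXiv v4)] -/
theorem not_exists_isNaturalProof_sizeDistinguishers_VNP_io {c : ℕ}
    (hper : PermanentBorderExpHardIO F c) :
    ∃ b : ℕ, ∀ a n₀ : ℕ, ∃ n : ℕ, n₀ ≤ n ∧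
      ¬ ∃ D, IsNaturalProof (degLEMonomials n) (SmallDefinable F n b) (SizeDistinguishers F n a) D := by
  obtain ⟨b, hb⟩ := succinctHittingSets_sizeDistinguishers_VNP_io_of_permanentBorderExpHardIO hper
  refine ⟨b, fun a n₀ => ?_⟩
  obtain ⟨n, hn, h⟩ := hb a n₀
  refine ⟨n, hn, ?_⟩
  rw [exists_isNaturalProof_iff, not_not]
  exact h

/-- The approximative i.o. hypothesis also yields the EXACT i.o. theorem's conclusion
(bounded-degree distinguishers) — consistency with `succinctHittingSetsFromVNP_io_of_permanentExpHardIO`.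
[cite: ChatterjeeKumarRamyaSaptharishiTengse2020, Thm. 1.13 and Thm. 1.10 (arXiv v4)] -/
theorem succinctHittingSetsFromVNP_io_of_permanentBorderExpHardIO {c : ℕ}
    (hper : PermanentBorderExpHardIO F c) :
    ∃ b : ℕ, ∀ a n₀ : ℕ, ∃ n : ℕ, n₀ ≤ n ∧
      IsSuccinctHittingSet (degLEMonomials n) (SmallDefinable F n b) (Distinguishers F n a) :=
  succinctHittingSetsFromVNP_io_of_permanentExpHardIO hper.permanentExpHardIO

end IO

/-! ### Equations: "there are no efficiently computable equations for `VNP`" (family form) -/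

section Equations

variable (F : Type*) [Field F]

/-- **A family of efficiently COMPUTABLE equations for a class, no degree bound** (the notion
negated by v4 Thm. 1.13: "there are no efficiently computable equations for `VNP`", degree being
irrelevant): ONE level `a` and ONE family `P_n ≠ 0` of circuit size `≤ N^a` in the
`N = binom(2n,n)` coefficient variables (`SizeDistinguishers F n a`) that, for every class exponent
`b`, eventually vanishes on the coefficient vectors of the slice `𝒞 n b`. Twin of the tree's
`HasEfficientEquations` (size AND degree `≤ N^a`, KRST 2022 reading), which implies it.
[cite: ChatterjeeKumarRamyaSaptharishiTengse2020, Thm. 1.13 (arXiv v4; "no efficiently computable equations for VNP")] -/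
def HasEfficientSizeEquations (𝒞 : (n : ℕ) → ℕ → Set (MvPolynomial (Fin n) F)) : Prop :=
  ∃ a : ℕ, ∃ P : (n : ℕ) → MvPolynomial (degLEMonomials n) F,
    (∃ n₁ : ℕ, ∀ n : ℕ, n₁ ≤ n → P n ≠ 0 ∧ P n ∈ SizeDistinguishers F n a) ∧
      ∀ b : ℕ, ∃ n₀ : ℕ, ∀ n : ℕ, n₀ ≤ n →
        ∀ f ∈ 𝒞 n b, eval (coeffVector (degLEMonomials n) f) (P n) = 0

variable {F}

/-- Bounded-degree efficient equations are efficient size-equations.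
[cite: ChatterjeeKumarRamyaSaptharishiTengse2020, Thm. 1.13 vs Thm. 1.10 (arXiv v4)] -/
theorem HasEfficientEquations.hasEfficientSizeEquations
    {𝒞 : (n : ℕ) → ℕ → Set (MvPolynomial (Fin n) F)} (h : HasEfficientEquations F 𝒞) :
    HasEfficientSizeEquations F 𝒞 := by
  obtain ⟨a, P, ⟨n₁, hP⟩, hvan⟩ := h
  exact ⟨a, P, ⟨n₁, fun n hn => ⟨(hP n hn).1, distinguishers_subset_sizeDistinguishers n a (hP n hn).2⟩⟩,
    hvan⟩

/-- A family of efficient size-equations of level `a` makes the class fail, for EVERY exponent `b`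
and all large `n`, to hit `SizeDistinguishers F n a` (FSV Thm. 4 direction, family form; twin of
`exists_not_isSuccinctHittingSet_of_hasEfficientEquations`).
[cite: ChatterjeeKumarRamyaSaptharishiTengse2020, Thm. 1.13 (arXiv v4)] -/
theorem exists_not_isSuccinctHittingSet_of_hasEfficientSizeEquations
    {𝒞 : (n : ℕ) → ℕ → Set (MvPolynomial (Fin n) F)} (h : HasEfficientSizeEquations F 𝒞) :
    ∃ a : ℕ, ∀ b : ℕ, ∃ n₀ : ℕ, ∀ n : ℕ, n₀ ≤ n →
      ¬ IsSuccinctHittingSet (degLEMonomials n) (𝒞 n b) (SizeDistinguishers F n a) := by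
  obtain ⟨a, P, ⟨n₁, hP⟩, hvan⟩ := h
  refine ⟨a, fun b => ?_⟩
  obtain ⟨n₀, hn₀⟩ := hvan b
  refine ⟨max n₀ n₁, fun n hn hhit => ?_⟩
  obtain ⟨hne, hmem⟩ := hP n ((le_max_right _ _).trans hn)
  obtain ⟨f, hf, hfne⟩ := hhit (P n) hmem hne
  exact hfne (hn₀ n ((le_max_left _ _).trans hn) f hf)

variable [CharZero F]

namespace CKRST2020

/-- **v4 Thm. 1.13, family form under the printed (i.o.) hypothesis — PROVED:** if the permanent
requires approximative circuits of size `2^{m^{1/c}}` for infinitely many `m = j^c`, then `VNP`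
(the slices `SmallDefinable F n b`) has NO family of efficiently computable equations, whatever
their degree. [cite: ChatterjeeKumarRamyaSaptharishiTengse2020, Thm. 1.13 (arXiv v4)] -/
theorem thm_1_13_not_hasEfficientSizeEquations_VNP_io {c : ℕ} (hper : PermanentBorderExpHardIO F c) :
    ¬ HasEfficientSizeEquations F (SmallDefinable F) := by
  intro h
  obtain ⟨b, hb⟩ := succinctHittingSets_sizeDistinguishers_VNP_io_of_permanentBorderExpHardIO hper
  obtain ⟨a, ha⟩ := exists_not_isSuccinctHittingSet_of_hasEfficientSizeEquations h
  obtain ⟨n₀, hn₀⟩ := ha b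
  obtain ⟨n, hn, hhit⟩ := hb a n₀
  exact hn₀ n hn hhit

/-- **v4 Thm. 1.13, family form under the almost-everywhere hypothesis — PROVED.**
[cite: ChatterjeeKumarRamyaSaptharishiTengse2020, Thm. 1.13 (arXiv v4)] -/
theorem thm_1_13_not_hasEfficientSizeEquations_VNP {c m₀ : ℕ}
    (hper : PermanentBorderExpHardWith F c m₀) :
    ¬ HasEfficientSizeEquations F (SmallDefinable F) :=
  thm_1_13_not_hasEfficientSizeEquations_VNP_io hper.io

/-- In particular no bounded-degree efficient equations either (the exact theorem's family form,
recovered from the approximative hypothesis). [cite: ChatterjeeKumarRamyaSaptharishiTengse2020, Thm. 1.13 and Thm. 1.10 (arXiv v4)] -/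
theorem thm_1_13_not_hasEfficientEquations_VNP {c m₀ : ℕ}
    (hper : PermanentBorderExpHardWith F c m₀) :
    ¬ HasEfficientEquations F (SmallDefinable F) :=
  fun h => thm_1_13_not_hasEfficientSizeEquations_VNP hper h.hasEfficientSizeEquations

end CKRST2020

end Equations

end Literature.Barriers.ValiantsHypothesis

end
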